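import Summits.QuantumFields.BalabanUV.T4Continuum.Support.NE7PairTransport
import HarnessLib

/-!
# NE7PairChartCorners — CORNER CONSISTENCY AND SITE-CLOSENESS OF A PINNED PAIR-CHART FAMILY (F318): for a family of unitary site gauges `g ζ`
# pinned at the block corners (`g ζ (M•ζ) = 1`) with pair defect `≤ η_ch` on the radius-`M` cube around `M•ζ`, and corner-segment data
# `‖U′(Γ) − U_s(Γ)‖ ≤ S` on every top corner segment: (i) `‖g ζ (M•(ζ+σ)) − 1‖ ≤ d·(Mη_ch + S)` for `σ ∈ {−1,0,1}^d`; (ii) two charts whose cubes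
# both contain a site `x` agree there up to `τ_cc = 2d(Mη_ch + S) + 2dMη_ch`

Cell `pub-balaban`, sub-cell t4, lineage `b2b-balaban-t4-ne7-p1` (CRUX PROVER NE7 #1 = OWNER of row NE7), gen 94; memo
`t4/b2b-balaban-t4-ne7-p1-g94/PAIR-REP-ROAD.md` §4.  File 4 of the road to the PAIR RESIDUAL SUP-REPRESENTATIVE; over F316 `NE7PairTransport` (corner consistency along
one segment; transport across a box).  (i) walks from `M•ζ` to `M•(ζ+σ)` one coordinate at a time inside the cube (each axis step is F316's forward or backward
corner letter); (ii) walks from the FLOOR CORNER `M•⌊x∕M⌋` (a corner of both cubes, within `{−1,0,1}^d` of both indices) to `x` inside the intersection of the two cubes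
(F316's box transport with both charts good there).  These two numbers (`δ_c`, `τ_cc`) are the only geometric inputs of the gluing induction (F320).
WHAT ([folklore]; 0 def, 0 sorry; any C⋆-algebra, any `d`): `norm_corner_family_le` (i), `floorCorner_mem` (the floor corner is adjacent to every cube containing `x`),
`norm_chart_sub_chart_le` (ii).
HONEST FRAMING: bookkeeping; the family and the segment datum `S` are HYPOTHESES (supplied for d = 4 by F317 `NE7PairCubeChart.exists_pair_chart_family` and by the
tree's `NE7IteratedAverageSegment.norm_cavgIter_sub_seg_le_top` at a pair with equal top averages); nothing of Bałaban's asserted; hleaves NOT discharged; NE7 NOT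
PROVED; spine 0∕9; finite T⁴ rung (B)+1 — NOT infinite volume, NOT mass gap, NOT `BetaPertH`, NOT Clay.  Axioms ⊆ {propext, Classical.choice, Quot.sound}.
-/

set_option autoImplicit false

open NormedSpace
open scoped BigOperators

namespace Summit.QuantumFields.BalabanUV.T4Continuum.NE7PairChartCorners

open Literature.MathematicalPhysics.QuantumFieldTheory.Balaban1983to89
open MatrixLog B7Prop1Explicit B7Prop2Explicit UnitaryRootInterpolation UnitaryGeodesic NE7PairGlueStep NE7PairTransport

noncomputable section

variable {𝔸 : Type*} [CStarAlgebra 𝔸] [Nontrivial 𝔸] {d : ℕ}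

/-! ## §1 Corner consistency of one pinned chart -/

/-- **CORNER CONSISTENCY OF A PINNED CHART**: `g` unitary with `g(M•ζ) = 1`, pair defect `≤ η` on every bond `⟨y, y + e_κ⟩` with `|y − M•ζ|_∞ ≤ M`, and the
corner-segment data `‖U′(M•ξ; [·, · + Me_i]) − U_s(M•ξ; [·, · + Me_i])‖ ≤ S` at every integer corner `ξ`: then for every `σ ∈ {−1,0,1}^d`,
`‖g(M•(ζ + σ)) − 1‖ ≤ d·(Mη + S)`. [folklore] -/
theorem norm_corner_family_le {Us U' : Site d → Fin d → 𝔸ˣ} (hUs : ∀ x μ, Us x μ ∈ unitaryUnits 𝔸) (hU' : ∀ x μ, U' x μ ∈ unitaryUnits 𝔸)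
    {g : Site d → 𝔸ˣ} (hg : ∀ x, g x ∈ unitaryUnits 𝔸) {M : ℕ} {ζ : Site d} (hpin : g ((M : ℤ) • ζ) = 1) {η S : ℝ} (hη : 0 ≤ η) (hS0 : 0 ≤ S)
    (herr : ∀ (y : Site d) (κ : Fin d), (∀ i, |y i - (M : ℤ) * ζ i| ≤ (M : ℤ)) →
      ‖(((Us y κ)⁻¹ * gaugeAct g U' y κ : 𝔸ˣ) : 𝔸) - 1‖ ≤ η)
    (hS : ∀ (ξ : Site d) (i : Fin d),
      ‖((hol U' ((M : ℤ) • ξ) (seg i (M : ℤ)) : 𝔸ˣ) : 𝔸) - ((hol Us ((M : ℤ) • ξ) (seg i (M : ℤ)) : 𝔸ˣ) : 𝔸)‖ ≤ S)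
    {σ : Site d} (hσ : ∀ i, σ i = -1 ∨ σ i = 0 ∨ σ i = 1) :
    ‖(((g ((M : ℤ) • (ζ + σ))) : 𝔸ˣ) : 𝔸) - 1‖ ≤ (d : ℝ) * ((M : ℝ) * η + S) := by
  classical
  -- the partially moved corner index
  let r : Finset (Fin d) → Site d := fun T i => if i ∈ T then ζ i + σ i else ζ i
  have hr_cube : ∀ (T : Finset (Fin d)) (i : Fin d), |(M : ℤ) * r T i - (M : ℤ) * ζ i| ≤ (M : ℤ) := by
    intro T i
    have hM0 : (0 : ℤ) ≤ M := Int.natCast_nonneg M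
    simp only [r]
    split_ifs
    · rcases hσ i with h | h | h <;> · rw [h]; rw [abs_le]; constructor <;> nlinarith
    · simp [hM0]
  have key : ∀ T : Finset (Fin d), ‖(((g ((M : ℤ) • r T)) : 𝔸ˣ) : 𝔸) - 1‖ ≤ (T.card : ℝ) * ((M : ℝ) * η + S) := by
    intro T
    induction T using Finset.induction_on with
    | empty =>
        have : r ∅ = ζ := by funext i; simp [r]
        rw [this, hpin]; simp
    | insert i T hiT ih =>
        have hstep_nonneg : 0 ≤ (M : ℝ) * η + S := by positivity
        rw [Finset.card_insert_of_notMem hiT]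
        -- the new corner differs from the old one by `M σ_i e_i`
        have hnext : (M : ℤ) • r (insert i T) = (M : ℤ) • r T + ((M : ℤ) * σ i) • e i := by
          funext j
          simp only [r, Finset.mem_insert, Pi.add_apply, Pi.smul_apply, e_apply, smul_eq_mul]
          by_cases hji : j = i
          · subst hji; simp [hiT]; ring
          · simp [hji]
        -- goodness on the two candidate segments (upward from the old corner, or upward from the new lower corner)
        have hseg_up : σ i = 1 → ∀ j : ℕ, j < M →
            ‖(((Us ((M : ℤ) • r T + (j : ℤ) • e i) i)⁻¹ * gaugeAct g U' ((M : ℤ) • r T + (j : ℤ) • e i) i : 𝔸ˣ) : 𝔸) - 1‖ ≤ η := by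
          intro hσi j hj
          refine herr _ i (fun l => ?_)
          simp only [Pi.add_apply, Pi.smul_apply, e_apply, smul_eq_mul]
          by_cases hl : l = i
          · subst hl
            simp only [if_true, mul_one, r, hiT, if_false]
            have hj' : (j : ℤ) < M := by exact_mod_cast hj
            rw [abs_le]; constructor <;> linarith
          · simp only [if_neg hl, mul_zero, add_zero]; exact hr_cube T l
        have hseg_down : σ i = -1 → ∀ j : ℕ, j < M →
            ‖(((Us ((M : ℤ) • r (insert i T) + (j : ℤ) • e i) i)⁻¹ * gaugeAct g U' ((M : ℤ) • r (insert i T) + (j : ℤ) • e i) i : 𝔸ˣ) : 𝔸) - 1‖ ≤ η := by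
          intro hσi j hj
          refine herr _ i (fun l => ?_)
          rw [hnext]
          simp only [Pi.add_apply, Pi.smul_apply, e_apply, smul_eq_mul]
          by_cases hl : l = i
          · subst hl
            simp only [if_true, mul_one, r, hiT, if_false, hσi]
            have hj' : (j : ℤ) < M := by exact_mod_cast hj
            rw [abs_le]; constructor <;> linarith
          · simp only [if_neg hl, mul_zero, add_zero]; exact hr_cube T l
        rcases hσ i with h1 | h0 | h1
        · -- downward: the new corner is the LOWER end of a segment ending at the old corner
          have hup : (M : ℤ) • r (insert i T) + (M : ℤ) • e i = (M : ℤ) • r T := by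
            rw [hnext, h1, add_assoc, ← add_smul]; simp
          have h := norm_corner_le_succ hUs hU' hg ((M : ℤ) • r (insert i T)) i M (hseg_down h1) (hS (r (insert i T)) i)
          rw [hup] at h
          calc _ ≤ ‖(((g ((M : ℤ) • r T)) : 𝔸ˣ) : 𝔸) - 1‖ + (M : ℝ) * η + S := h
            _ ≤ (T.card : ℝ) * ((M : ℝ) * η + S) + ((M : ℝ) * η + S) := by linarith [ih]
            _ = _ := by push_cast; ring
        · -- no move
          have hsame : (M : ℤ) • r (insert i T) = (M : ℤ) • r T := by rw [hnext, h0]; simp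
          rw [hsame]
          calc _ ≤ (T.card : ℝ) * ((M : ℝ) * η + S) := ih
            _ ≤ _ := by push_cast; nlinarith
        · -- upward
          have hup : (M : ℤ) • r T + (M : ℤ) • e i = (M : ℤ) • r (insert i T) := by rw [hnext, h1, mul_one]
          have h := norm_corner_succ_le hUs hU' hg ((M : ℤ) • r T) i M (hseg_up h1) (hS (r T) i)
          rw [hup] at h
          calc _ ≤ ‖(((g ((M : ℤ) • r T)) : 𝔸ˣ) : 𝔸) - 1‖ + (M : ℝ) * η + S := h
            _ ≤ (T.card : ℝ) * ((M : ℝ) * η + S) + ((M : ℝ) * η + S) := by linarith [ih]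
            _ = _ := by push_cast; ring
  have hfin : r Finset.univ = ζ + σ := by funext i; simp [r]
  have h := key Finset.univ
  rw [hfin, Finset.card_univ, Fintype.card_fin] at h
  exact h

/-! ## §2 The floor corner of a site and the closeness of two charts at a common site -/

/-- **THE FLOOR CORNER IS ADJACENT**: if `|x − M•ζ|_∞ ≤ M` (`M ≥ 1`) then the floor index `⌊x∕M⌋` is within `{−1,0,1}^d` of `ζ`, and
`M⌊x_i∕M⌋ ≤ x_i < M⌊x_i∕M⌋ + M`. [folklore] -/
theorem floorCorner_adjacent {M : ℕ} (hM : 1 ≤ M) {x ζ : Site d} (hx : ∀ i, |x i - (M : ℤ) * ζ i| ≤ (M : ℤ)) (i : Fin d) :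
    (x i / (M : ℤ) - ζ i = -1 ∨ x i / (M : ℤ) - ζ i = 0 ∨ x i / (M : ℤ) - ζ i = 1) ∧
      (M : ℤ) * (x i / (M : ℤ)) ≤ x i ∧ x i < (M : ℤ) * (x i / (M : ℤ)) + M := by
  have hM0 : (0 : ℤ) < M := by exact_mod_cast hM
  have hlo : (M : ℤ) * (x i / (M : ℤ)) ≤ x i := Int.mul_ediv_self_le (by omega)
  have hhi : x i < (M : ℤ) * (x i / (M : ℤ)) + M := by
    have := Int.lt_mul_ediv_self_add hM0 (x := x i)
    linarith
  have hxi := hx i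
  rw [abs_le] at hxi
  refine ⟨?_, hlo, hhi⟩
  -- `M(q − ζ) ∈ (−2M, 2M)` forces `q − ζ ∈ {−1,0,1}`
  have h1 : (M : ℤ) * (x i / (M : ℤ) - ζ i) < 2 * M := by nlinarith
  have h2 : -(2 * (M : ℤ)) < (M : ℤ) * (x i / (M : ℤ) - ζ i) := by nlinarith
  have h3 : x i / (M : ℤ) - ζ i < 2 := by
    by_contra h; push Not at h; nlinarith
  have h4 : -2 < x i / (M : ℤ) - ζ i := by
    by_contra h; push Not at h; nlinarith
  omega

/-- **TWO CHARTS AT A COMMON SITE**: a pinned chart family (`g ζ (M•ζ) = 1`, pair defect `≤ η` on the radius-`M` cube around `M•ζ`, all ζ) with corner-segment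
data `S`: if `x` lies in the cubes of both `ζ` and `ζ′`, then `‖g ζ x − g ζ′ x‖ ≤ 2d(Mη + S) + 2dMη`. [folklore] -/
theorem norm_chart_sub_chart_le {Us U' : Site d → Fin d → 𝔸ˣ} (hUs : ∀ x μ, Us x μ ∈ unitaryUnits 𝔸) (hU' : ∀ x μ, U' x μ ∈ unitaryUnits 𝔸)
    {g : Site d → Site d → 𝔸ˣ} (hg : ∀ ζ x, g ζ x ∈ unitaryUnits 𝔸) {M : ℕ} (hM : 1 ≤ M) (hpin : ∀ ζ, g ζ ((M : ℤ) • ζ) = 1)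
    {η S : ℝ} (hη : 0 ≤ η) (hS0 : 0 ≤ S)
    (herr : ∀ (ζ y : Site d) (κ : Fin d), (∀ i, |y i - (M : ℤ) * ζ i| ≤ (M : ℤ)) →
      ‖(((Us y κ)⁻¹ * gaugeAct (g ζ) U' y κ : 𝔸ˣ) : 𝔸) - 1‖ ≤ η)
    (hS : ∀ (ξ : Site d) (i : Fin d),
      ‖((hol U' ((M : ℤ) • ξ) (seg i (M : ℤ)) : 𝔸ˣ) : 𝔸) - ((hol Us ((M : ℤ) • ξ) (seg i (M : ℤ)) : 𝔸ˣ) : 𝔸)‖ ≤ S)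
    {ζ ζ' x : Site d} (hxζ : ∀ i, |x i - (M : ℤ) * ζ i| ≤ (M : ℤ)) (hxζ' : ∀ i, |x i - (M : ℤ) * ζ' i| ≤ (M : ℤ)) :
    ‖((g ζ x : 𝔸ˣ) : 𝔸) - ((g ζ' x : 𝔸ˣ) : 𝔸)‖ ≤ 2 * ((d : ℝ) * ((M : ℝ) * η + S)) + 2 * (d : ℝ) * (M : ℝ) * η := by
  -- the floor corner
  let q : Site d := fun i => x i / (M : ℤ)
  have hq := fun i => floorCorner_adjacent hM hxζ i
  have hq' := fun i => floorCorner_adjacent hM hxζ' i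
  -- both charts are within `δ_c` of `1` at `M•q`
  have hσ : ∀ i, (q - ζ) i = -1 ∨ (q - ζ) i = 0 ∨ (q - ζ) i = 1 := fun i => (hq i).1
  have hσ' : ∀ i, (q - ζ') i = -1 ∨ (q - ζ') i = 0 ∨ (q - ζ') i = 1 := fun i => (hq' i).1
  have hc : ‖(((g ζ ((M : ℤ) • q)) : 𝔸ˣ) : 𝔸) - 1‖ ≤ (d : ℝ) * ((M : ℝ) * η + S) := by
    have h := norm_corner_family_le hUs hU' (hg ζ) (hpin ζ) hη hS0 (herr ζ) hS hσ
    rwa [add_sub_cancel] at h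
  have hc' : ‖(((g ζ' ((M : ℤ) • q)) : 𝔸ˣ) : 𝔸) - 1‖ ≤ (d : ℝ) * ((M : ℝ) * η + S) := by
    have h := norm_corner_family_le hUs hU' (hg ζ') (hpin ζ') hη hS0 (herr ζ') hS hσ'
    rwa [add_sub_cancel] at h
  -- transport from the corner `M•q` to `x` inside the box `M•q ≤ · ≤ x` (contained in both cubes)
  have hbox := norm_ratio_box_le hUs hU' (u := g ζ') (v := g ζ) (hg ζ') (hg ζ) (lo := (M : ℤ) • q) (hi := x) (ηu := η) (ηv := η)
    (fun y μ hlo hhi => by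
      have hyζ : ∀ ξ : Site d, (∀ i, (q - ξ) i = -1 ∨ (q - ξ) i = 0 ∨ (q - ξ) i = 1) → (∀ i, |x i - (M : ℤ) * ξ i| ≤ (M : ℤ)) →
          ∀ i, |y i - (M : ℤ) * ξ i| ≤ (M : ℤ) := by
        intro ξ hξ hxξ i
        have h1 := hlo i
        have h2 := hhi i
        simp only [Pi.smul_apply, smul_eq_mul] at h1
        have h2' : y i ≤ x i := by
          have := h2; simp only [Pi.add_apply, e_apply] at this
          split_ifs at this <;> linarith
        have hx' := hxξ i; rw [abs_le] at hx'
        have hM0 : (0 : ℤ) ≤ M := Int.natCast_nonneg M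
        rw [abs_le]; constructor
        · rcases hξ i with h | h | h <;> · simp only [Pi.sub_apply] at h; nlinarith
        · linarith
      exact ⟨herr ζ' y μ (hyζ ζ' hσ' hxζ'), herr ζ y μ (hyζ ζ hσ hxζ)⟩)
    (p := (M : ℤ) • q) (q := x)
    (fun i => ⟨le_rfl, by simp only [Pi.smul_apply, smul_eq_mul]; exact (hq i).2.1⟩)
    (fun i => ⟨by simp only [Pi.smul_apply, smul_eq_mul]; exact (hq i).2.1, le_rfl⟩)
  -- the ratio at the corner and the path length
  have hstart : ‖((g ζ ((M : ℤ) • q) * (g ζ' ((M : ℤ) • q))⁻¹ : 𝔸ˣ) : 𝔸) - 1‖ ≤ 2 * ((d : ℝ) * ((M : ℝ) * η + S)) := by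
    rw [norm_mul_inv_sub_one (hg ζ' _)]
    calc _ = ‖(((g ζ ((M : ℤ) • q) : 𝔸ˣ) : 𝔸) - 1) + (1 - ((g ζ' ((M : ℤ) • q) : 𝔸ˣ) : 𝔸))‖ := by rw [sub_add_sub_cancel]
      _ ≤ ‖((g ζ ((M : ℤ) • q) : 𝔸ˣ) : 𝔸) - 1‖ + ‖1 - ((g ζ' ((M : ℤ) • q) : 𝔸ˣ) : 𝔸)‖ := norm_add_le _ _
      _ ≤ _ := by rw [norm_sub_rev (1 : 𝔸)]; linarith
  have hlen : (∑ i, (|x i - ((M : ℤ) • q) i| : ℝ)) ≤ (d : ℝ) * (M : ℝ) := by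
    have hterm : ∀ i, (|x i - ((M : ℤ) • q) i| : ℝ) ≤ (M : ℝ) := by
      intro i
      have h1 := (hq i).2.1; have h2 := (hq i).2.2
      simp only [Pi.smul_apply, smul_eq_mul]
      rw [abs_le]; constructor
      · have : ((M : ℤ) : ℝ) * ((x i / (M : ℤ) : ℤ) : ℝ) ≤ (x i : ℝ) := by exact_mod_cast h1
        push_cast at this ⊢; linarith
      · have : ((x i : ℤ) : ℝ) < ((M : ℤ) : ℝ) * ((x i / (M : ℤ) : ℤ) : ℝ) + (M : ℝ) := by exact_mod_cast h2
        push_cast at this ⊢; linarith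
    calc (∑ i, (|x i - ((M : ℤ) • q) i| : ℝ)) ≤ ∑ _i : Fin d, (M : ℝ) := Finset.sum_le_sum fun i _ => hterm i
      _ = (d : ℝ) * M := by simp
  rw [← norm_mul_inv_sub_one (hg ζ' x)]
  have hηη : 0 ≤ η + η := by linarith
  calc _ ≤ ‖((g ζ ((M : ℤ) • q) * (g ζ' ((M : ℤ) • q))⁻¹ : 𝔸ˣ) : 𝔸) - 1‖ + (∑ i, (|x i - ((M : ℤ) • q) i| : ℝ)) * (η + η) := hbox
    _ ≤ 2 * ((d : ℝ) * ((M : ℝ) * η + S)) + ((d : ℝ) * (M : ℝ)) * (η + η) := by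
        have := mul_le_mul_of_nonneg_right hlen hηη; linarith
    _ = _ := by ring

end

end Summit.QuantumFields.BalabanUV.T4Continuum.NE7PairChartCorners
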